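import Mathlib
import Literature.Combinatorics.Optimization.HoffmanCirculation
import Literature.Combinatorics.Optimization.HoffmanCirculationProofs
import HarnessLib

/-!
# The bipartite `f`-factor theorem (Ore 1956) from Hoffman's circulation theorem

Topic `Combinatorics/Optimization`.  A bipartite graph with colour classes `rows = cols = Fin n`,
given as a set of cells `Y ⊆ Fin n × Fin n`, has an `f`-REGULAR spanning subgraph (an
`f`-factor: a subset `Y' ⊆ Y` with exactly `f` cells in every row and every column) as soon as

  `f · (#A + #B) ≤ f · n + e_Y(A, B)`  for all row sets `A` and column sets `B`,

where `e_Y(A, B) = #{(i, j) ∈ Y : i ∈ A, j ∈ B}`.  (The condition is also necessary: an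
`f`-factor has `f #A` cells in the rows `A`, at most `f (n - #B)` of them in the columns outside
`B`.)  This is the bipartite case of the `f`-factor theorem: O. Ore, *Studies on directed graphs
I*, Ann. of Math. 63 (1956) 383–406 [Ore1956] (existence of a subgraph with prescribed degrees;
equivalently max-flow min-cut on the assignment network).  Textbook form: J. A. Bondy,
U. S. R. Murty, *Graph Theory* (2008), §20.3, as a consequence of Hoffman's circulation theorem,
Theorem 20.9 [BondyMurty2008].

## Proof route (this file)

From the TREE theorem `Literature.Combinatorics.Optimization.Hoffman1960_circulationTheorem_holds`
(integrality part).  Circulation network: vertices `V := (Fin n ⊕ Fin n) ⊕ Unit` (rows, columns,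
a hub `z`), arcs `A := (Fin n × Fin n ⊕ Fin n) ⊕ Fin n`: every cell `(i, j)` is an arc
`row i → col j` with bounds `[0, 1_{(i,j) ∈ Y}]`, every column `j` an arc `col j → z` with
bounds `[f, f]`, every row `i` an arc `z → row i` with bounds `[f, f]` (all in `ℤ`).  Hoffman's cut
condition `b⁻(X) ≤ c⁺(X)` at `X ⊆ V` with row part `R_X` and column part `C_X` reads, if
`z ∈ X`, `f · #(cols ∉ X) ≤ e_Y(R_X, cols ∉ X) + f · #(rows ∉ X)`, and if `z ∉ X`,
`f · #R_X ≤ e_Y(R_X, cols ∉ X) + f · #C_X`; both are the hypothesis at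
`(A, B) := (R_X, cols ∉ X)`.  An integral feasible circulation `g` equals `f` on the hub arcs and
is `0/1` on cells, `0` off `Y`; conservation at `row i` / `col j` says that the `0/1` matrix `g`
has all row and column sums `f` (`exists_zeroOne_rowColSum_of_cut_condition`), and
`Y' := {g = 1}` is the `f`-factor (`exists_regular_subgraph_of_cut_condition`).

## What is not here

Only sufficiency is proved (necessity is the easy count above and is not needed by the users);
the general (non-bipartite) `f`-factor theorem of Tutte is not touched.  Wanted by
`Summit.ValiantsHypothesis.…DivisionGap.PerMultiplesHard` (line `uncharged-face-walk`, stub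
`stub_regularFactor`).
-/

namespace Literature.Combinatorics.Optimization

open Finset

/-- `∑_i [p i] · f = f · #{i | p i}` over a finite type. [folklore] -/
theorem sum_ite_const_zero_eq_mul_card {ι : Type*} [Fintype ι] (p : ι → Prop)
    [DecidablePred p] (f : ℤ) : (∑ i, if p i then f else 0) = f * (univ.filter p).card := by
  rw [← Finset.sum_filter, Finset.sum_const, nsmul_eq_mul, mul_comm]

/-- **The `0/1`-matrix form of the bipartite `f`-factor theorem.**  If
`f (#A + #B) ≤ f n + e_Y(A, B)` for all row sets `A` and column sets `B`, there is a `0/1` matrix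
supported on `Y` all of whose row sums and column sums equal `f`.  Proof: Hoffman's circulation
theorem (integral form, tree theorem `Hoffman1960_circulationTheorem_holds`) on the network
described in the module docstring. [cite: Ore1956, Thm (bipartite f-factors)] -/
theorem exists_zeroOne_rowColSum_of_cut_condition (n f : ℕ) (Y : Finset (Fin n × Fin n))
    (hY : ∀ A B : Finset (Fin n),
      f * (A.card + B.card) ≤ f * n + (Y.filter fun e => e.1 ∈ A ∧ e.2 ∈ B).card) :
    ∃ g : Fin n × Fin n → ℤ, (∀ e, g e = 0 ∨ g e = 1) ∧ (∀ e, e ∉ Y → g e = 0) ∧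
      (∀ i : Fin n, ∑ j, g (i, j) = f) ∧ (∀ j : Fin n, ∑ i, g (i, j) = f) := by
  -- the network: vertices `(rows ⊕ cols) ⊕ {z}`, arcs `(cells ⊕ column arcs) ⊕ row arcs`
  obtain ⟨tail, ht1, ht2, ht3⟩ :
      ∃ tail : (Fin n × Fin n ⊕ Fin n) ⊕ Fin n → (Fin n ⊕ Fin n) ⊕ Unit,
        (∀ e, tail (Sum.inl (Sum.inl e)) = Sum.inl (Sum.inl e.1)) ∧
        (∀ j, tail (Sum.inl (Sum.inr j)) = Sum.inl (Sum.inr j)) ∧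
        (∀ i, tail (Sum.inr i) = Sum.inr ()) :=
    ⟨Sum.elim (Sum.elim (fun e => Sum.inl (Sum.inl e.1)) (fun j => Sum.inl (Sum.inr j)))
      (fun _ => Sum.inr ()), fun _ => rfl, fun _ => rfl, fun _ => rfl⟩
  obtain ⟨head, hh1, hh2, hh3⟩ :
      ∃ head : (Fin n × Fin n ⊕ Fin n) ⊕ Fin n → (Fin n ⊕ Fin n) ⊕ Unit,
        (∀ e, head (Sum.inl (Sum.inl e)) = Sum.inl (Sum.inr e.2)) ∧
        (∀ j, head (Sum.inl (Sum.inr j)) = Sum.inr ()) ∧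
        (∀ i, head (Sum.inr i) = Sum.inl (Sum.inl i)) :=
    ⟨Sum.elim (Sum.elim (fun e => Sum.inl (Sum.inr e.2)) (fun _ => Sum.inr ()))
      (fun i => Sum.inl (Sum.inl i)), fun _ => rfl, fun _ => rfl, fun _ => rfl⟩
  obtain ⟨b, hb1, hb2, hb3⟩ : ∃ b : (Fin n × Fin n ⊕ Fin n) ⊕ Fin n → ℤ,
      (∀ e, b (Sum.inl (Sum.inl e)) = 0) ∧ (∀ j, b (Sum.inl (Sum.inr j)) = f) ∧
        (∀ i, b (Sum.inr i) = f) :=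
    ⟨Sum.elim (Sum.elim (fun _ => 0) (fun _ => (f : ℤ))) (fun _ => (f : ℤ)),
      fun _ => rfl, fun _ => rfl, fun _ => rfl⟩
  obtain ⟨c, hc1, hc2, hc3⟩ : ∃ c : (Fin n × Fin n ⊕ Fin n) ⊕ Fin n → ℤ,
      (∀ e, c (Sum.inl (Sum.inl e)) = if e ∈ Y then 1 else 0) ∧
        (∀ j, c (Sum.inl (Sum.inr j)) = f) ∧ (∀ i, c (Sum.inr i) = f) :=
    ⟨Sum.elim (Sum.elim (fun e => if e ∈ Y then 1 else 0) (fun _ => (f : ℤ)))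
      (fun _ => (f : ℤ)), fun _ => rfl, fun _ => rfl, fun _ => rfl⟩
  have hle : ∀ a, b a ≤ c a := by
    rintro ((e | j) | i)
    · rw [hb1, hc1]; split_ifs <;> norm_num
    · rw [hb2, hc2]
    · rw [hb3, hc3]
  -- Hoffman's cut condition `b⁻(X) ≤ c⁺(X)`
  have hcut : ∀ X : Finset ((Fin n ⊕ Fin n) ⊕ Unit),
      inSum tail head b X ≤ outSum tail head c X := by
    intro X
    -- the hypothesis at `A := rows in X`, `B := columns outside X`
    have hAB := hY (univ.filter fun i => Sum.inl (Sum.inl i) ∈ X)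
      (univ.filter fun j => Sum.inl (Sum.inr j) ∉ X)
    have hAc := Finset.card_filter_add_card_filter_not (s := (univ : Finset (Fin n)))
      (fun i => Sum.inl (Sum.inl i) ∈ X)
    have hBc := Finset.card_filter_add_card_filter_not (s := (univ : Finset (Fin n)))
      (fun j => Sum.inl (Sum.inr j) ∈ X)
    rw [Finset.card_univ, Fintype.card_fin] at hAc hBc
    -- the cell part of `c⁺(X)` is `e_Y(A, B)`
    have hE : (∑ e : Fin n × Fin n,
        if Sum.inl (Sum.inl e.1) ∈ X ∧ Sum.inl (Sum.inr e.2) ∉ X then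
          (if e ∈ Y then (1 : ℤ) else 0) else 0) =
        ((Y.filter fun e => (e.1 ∈ univ.filter fun i => Sum.inl (Sum.inl i) ∈ X) ∧
          e.2 ∈ univ.filter fun j => Sum.inl (Sum.inr j) ∉ X).card : ℤ) := by
      rw [Finset.natCast_card_filter, ← Finset.sum_subset (Finset.subset_univ Y)]
      · refine Finset.sum_congr rfl fun e he => ?_
        rw [if_pos he]
        simp only [Finset.mem_filter, Finset.mem_univ, true_and]
      · intro e _ he
        rw [if_neg he, ite_self]
    zify at hAB hAc hBc
    have hAc' := congrArg (HMul.hMul (f : ℤ)) hAc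
    have hBc' := congrArg (HMul.hMul (f : ℤ)) hBc
    rw [inSum_eq_sum_ite, outSum_eq_sum_ite]
    simp only [Fintype.sum_sum_type, ht1, ht2, ht3, hh1, hh2, hh3, hb1, hb2, hb3, hc1, hc2, hc3,
      ite_self, Finset.sum_const_zero, zero_add]
    by_cases hz : Sum.inr () ∈ X
    · -- hub inside `X`: `f · #(cols ∉ X) ≤ e_Y(A, B) + f · #(rows ∉ X)`
      simp only [hz, true_and, not_true_eq_false, and_false, if_false, Finset.sum_const_zero,
        add_zero]
      rw [hE, sum_ite_const_zero_eq_mul_card, sum_ite_const_zero_eq_mul_card]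
      linarith
    · -- hub outside `X`: `f · #R_X ≤ e_Y(A, B) + f · #C_X`
      simp only [hz, false_and, not_false_eq_true, and_true, if_false, Finset.sum_const_zero,
        add_zero, zero_add]
      rw [hE, sum_ite_const_zero_eq_mul_card, sum_ite_const_zero_eq_mul_card]
      linarith
  -- an integral feasible circulation
  obtain ⟨g, hcons, hbd⟩ := Hoffman1960_circulationTheorem_holds.2 ((Fin n ⊕ Fin n) ⊕ Unit)
    ((Fin n × Fin n ⊕ Fin n) ⊕ Fin n) tail head b c hle hcut
  have hrow : ∀ i, g (Sum.inr i) = f := fun i =>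
    le_antisymm (by simpa only [hc3] using (hbd (Sum.inr i)).2)
      (by simpa only [hb3] using (hbd (Sum.inr i)).1)
  have hcol : ∀ j, g (Sum.inl (Sum.inr j)) = f := fun j =>
    le_antisymm (by simpa only [hc2] using (hbd (Sum.inl (Sum.inr j))).2)
      (by simpa only [hb2] using (hbd (Sum.inl (Sum.inr j))).1)
  have hcell0 : ∀ e, 0 ≤ g (Sum.inl (Sum.inl e)) := fun e => by
    simpa only [hb1] using (hbd (Sum.inl (Sum.inl e))).1
  have hcell1 : ∀ e, g (Sum.inl (Sum.inl e)) ≤ if e ∈ Y then 1 else 0 := fun e => by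
    simpa only [hc1] using (hbd (Sum.inl (Sum.inl e))).2
  refine ⟨fun e => g (Sum.inl (Sum.inl e)), fun e => ?_, fun e he => ?_, fun i => ?_,
    fun j => ?_⟩
  · show g (Sum.inl (Sum.inl e)) = 0 ∨ g (Sum.inl (Sum.inl e)) = 1
    have h0 := hcell0 e
    have h1 : g (Sum.inl (Sum.inl e)) ≤ 1 := (hcell1 e).trans (by split_ifs <;> norm_num)
    omega
  · have h0 := hcell0 e
    have h1 := hcell1 e
    rw [if_neg he] at h1
    exact le_antisymm h1 h0
  · -- conservation at `row i`: `Σ_j g(i, j) = g(z → row i) = f`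
    have h := hcons (Sum.inl (Sum.inl i))
    rw [outSum_eq_sum_ite, inSum_eq_sum_ite] at h
    simp only [Fintype.sum_sum_type, ht1, ht2, ht3, hh1, hh2, hh3, Finset.mem_singleton,
      Sum.inl.injEq, reduceCtorEq, false_and, not_false_eq_true, and_true, if_false,
      Finset.sum_const_zero, add_zero, zero_add, Finset.sum_ite_eq', Finset.mem_univ,
      if_true] at h
    rw [hrow i, Fintype.sum_prod_type, Finset.sum_comm] at h
    simpa only [Finset.sum_ite_eq', Finset.mem_univ, if_true] using h
  · -- conservation at `col j`: `f = g(col j → z) = Σ_i g(i, j)`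
    have h := hcons (Sum.inl (Sum.inr j))
    rw [outSum_eq_sum_ite, inSum_eq_sum_ite] at h
    simp only [Fintype.sum_sum_type, ht1, ht2, ht3, hh1, hh2, hh3, Finset.mem_singleton,
      Sum.inl.injEq, Sum.inr.injEq, reduceCtorEq, false_and, not_false_eq_true, and_true,
      if_false, Finset.sum_const_zero, add_zero, zero_add, Finset.sum_ite_eq', Finset.mem_univ,
      if_true] at h
    rw [hcol j, Fintype.sum_prod_type] at h
    simpa only [Finset.sum_ite_eq', Finset.mem_univ, if_true] using h.symm

/-- **The bipartite `f`-factor theorem (Ore 1956).**  A bipartite graph `Y ⊆ Fin n × Fin n`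
(rows × columns) with `e_Y(A, B) ≥ f (#A + #B - n)` for all row sets `A` and column sets `B` —
stated additively, `f (#A + #B) ≤ f n + #{e ∈ Y : e.1 ∈ A, e.2 ∈ B}` — has an `f`-regular
spanning subgraph: some `Y' ⊆ Y` has exactly `f` cells in every row and in every column.
(Bipartite case of the `f`-factor theorem; here from Hoffman's circulation theorem via
`exists_zeroOne_rowColSum_of_cut_condition`, `Y' := {g = 1}`.)
[cite: Ore1956, Thm (bipartite f-factors)] -/
theorem exists_regular_subgraph_of_cut_condition (n f : ℕ) (Y : Finset (Fin n × Fin n))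
    (hY : ∀ A B : Finset (Fin n),
      f * (A.card + B.card) ≤ f * n + (Y.filter fun e => e.1 ∈ A ∧ e.2 ∈ B).card) :
    ∃ Y' : Finset (Fin n × Fin n), Y' ⊆ Y ∧
      (∀ i : Fin n, (Finset.univ.filter fun j : Fin n => (i, j) ∈ Y').card = f) ∧
      (∀ j : Fin n, (Finset.univ.filter fun i : Fin n => (i, j) ∈ Y').card = f) := by
  obtain ⟨g, h01, hY0, hr, hc⟩ := exists_zeroOne_rowColSum_of_cut_condition n f Y hY
  -- the number of `1`s of a `0/1` vector is its sum
  have hcount : ∀ v : Fin n → ℤ, (∀ k, v k = 0 ∨ v k = 1) →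
      ((univ.filter fun k => v k = 1).card : ℤ) = ∑ k, v k := by
    intro v hv
    rw [Finset.natCast_card_filter]
    refine Finset.sum_congr rfl fun k _ => ?_
    rcases hv k with h | h <;> simp [h]
  refine ⟨univ.filter fun e => g e = 1, fun e he => ?_, fun i => ?_, fun j => ?_⟩
  · rw [Finset.mem_filter] at he
    by_contra hne
    rw [hY0 e hne] at he
    exact zero_ne_one he.2
  · have h1 : (univ.filter fun j : Fin n =>
        (i, j) ∈ univ.filter fun e : Fin n × Fin n => g e = 1) =
          univ.filter fun j => g (i, j) = 1 := by
      ext j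
      simp only [Finset.mem_filter, Finset.mem_univ, true_and]
    rw [h1]
    exact_mod_cast (hcount (fun j => g (i, j)) fun j => h01 (i, j)).trans (hr i)
  · have h1 : (univ.filter fun i : Fin n =>
        (i, j) ∈ univ.filter fun e : Fin n × Fin n => g e = 1) =
          univ.filter fun i => g (i, j) = 1 := by
      ext i
      simp only [Finset.mem_filter, Finset.mem_univ, true_and]
    rw [h1]
    exact_mod_cast (hcount (fun i => g (i, j)) fun i => h01 (i, j)).trans (hc j)

end Literature.Combinatorics.Optimization
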